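import Literature.Analysis.FluidPDE.SobolevWholeSpace
import Literature.Analysis.FluidPDE.TaoEnstrophyLocalisationProofs
import Literature.Analysis.FluidPDE.VectorCalculus
import Literature.Analysis.FunctionSpaces.Mollification
import HarnessLib

/-!
# The Gagliardo–Nirenberg–Sobolev inequality for weakly differentiable functions

Analysis/FluidPDE support file (serves the discharge of `Literature.Analysis.FluidPDE.lerayHopfClass_L2L6`, the
Sobolev imbedding `L²(0, T; H¹) ⊂ L²(0, T; L⁶)` of the Leray–Hopf class, Escauriaza–Seregin–Šverák
2003, (1.11)–(1.12), in `FluidPDE/NSLerayHopfProofs`).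

Let `E` be a finite-dimensional real inner product space of dimension `n ≥ 1` with its Lebesgue
measure, `F` a finite-dimensional real normed space, `1 ≤ p < n`, `p'⁻¹ = p⁻¹ - n⁻¹`. The tree has
the Gagliardo–Nirenberg–Sobolev inequality `‖u‖_{L^{p'}} ≤ K ‖Du‖_{L^p}` for `C¹` functions
`u ∈ L^p` (`Literature.Analysis.FluidPDE.eLpNorm_le_eLpNorm_fderiv_of_eq_of_eLpNorm_lt_top`, `FluidPDE/SobolevWholeSpace`,
same constant `K = SNormLESNormFDerivOfEqConst F volume p` as Mathlib's `C¹_c` inequality). Here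
the differentiability hypothesis is weakened to a **weak** derivative in the sense of the
accepted `Literature.HasWeakFDerivOn ⊤ volume u G` (`FunctionSpaces/SobolevDomain`): for `u ∈ L^p` with
weak derivative `G`, `‖u‖_{L^{p'}} ≤ K ‖G‖_{L^p}` (Evans, *PDE*, §5.6.1, Thm. 1 with the density
argument of §5.3; Robinson–Rodrigo–Sadowski 2016, Thm. 1.7 (i) with `W₀^{1,p}(ℝⁿ) = W^{1,p}(ℝⁿ)`).

Proof: mollify. With the mollifier sequence `φₙ` of `Literature.Analysis.FunctionSpaces.exists_contDiffBump_seq`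
(`FunctionSpaces/Mollification`), `uₙ = φₙ ⋆ u` is `C¹` with `Duₙ = φₙ ⋆ G` (mollification
commutes with weak differentiation, `Literature.Analysis.FunctionSpaces.HasWeakFDerivOn.hasFDerivAt_convolution`),
`‖uₙ‖_p ≤ ‖u‖_p < ∞` and `‖Duₙ‖_p ≤ ‖G‖_p` (Young, `Literature.Analysis.FunctionSpaces.eLpNorm_normed_convolution_le`); the `C¹`
inequality gives `‖uₙ‖_{p'} ≤ K ‖G‖_p`, and since `uₙ → u` a.e. (`Literature.Analysis.FunctionSpaces.ae_tendsto_normed_convolution`)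
Fatou's lemma in `L^{p'}` (`MeasureTheory.Lp.eLpNorm_lim_le_liminf_eLpNorm`) gives
`‖u‖_{p'} ≤ K ‖G‖_p`. The case `n = 3`, `p = 2`, `p' = 6` is recorded with the Frobenius density
`|G|² = ∑ᵢ ‖G eᵢ‖²` of the accepted dissipation functionals (`Fluid.frobeniusNormSq`, which
dominates the operator norm, `Fluid.sq_opNorm_le_frobeniusNormSq`):
`‖u‖_{L⁶} ≤ K (∫ |G|²)^{1/2}` for `u ∈ L²(ℝ³)` with weak gradient `G`.

## Mathlib search

Mathlib (this pin) has the `C¹_c` inequality (`MeasureTheory.eLpNorm_le_eLpNorm_fderiv_of_eq`) and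
no weak derivatives (cf. the search notes of `FunctionSpaces/Mollification`); the tree's
`Literature.Analysis.FunctionSpaces.gagliardo_nirenberg_sobolev` (`FunctionSpaces/SobolevDomain`) is the abstract `W₀^{1,p}(Ω)`
closure-class statement (a named fact). The statement below is proved.

## References

* L. C. Evans, *Partial Differential Equations*, 2nd ed. (2010), §5.6.1, Thm. 1 (GNS for `C¹_c`),
  §5.3.1, Thm. 1 and App. C.4, Thm. 7 (mollification), §5.6.1, Thm. 2 (extension by density).
* J. C. Robinson, J. L. Rodrigo, W. Sadowski, *The three-dimensional Navier–Stokes equations*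
  (CUP 2016), Thm. 1.7 (i) (`‖u‖_{L^{p*}} ≤ c ‖∇u‖_{L^p}` on `W₀^{1,p}`; `W₀^{1,p}(ℝⁿ) = W^{1,p}(ℝⁿ)`).
* L. Escauriaza, G. Seregin, V. Šverák, *`L_{3,∞}`-solutions of Navier–Stokes equations and
  backward uniqueness*, Russ. Math. Surveys 58:2 (2003), (1.11)–(1.12) ("by standard imbeddings").
-/

noncomputable section

open MeasureTheory Filter Topology Set Function Module ContinuousLinearMap
open scoped ENNReal NNReal Convolution

namespace Literature.Analysis.FluidPDE

variable {E : Type*} [NormedAddCommGroup E] [InnerProductSpace ℝ E] [FiniteDimensional ℝ E]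
  [MeasurableSpace E] [BorelSpace E]
variable {F : Type*} [NormedAddCommGroup F] [NormedSpace ℝ F] [FiniteDimensional ℝ F]

/-- **Gagliardo–Nirenberg–Sobolev inequality for weak derivatives.** Let `E` have dimension
`n ≥ 1`, `1 ≤ p`, `p'⁻¹ = p⁻¹ - n⁻¹`, and let `u : E → F` lie in `L^p` and have the weak derivative
`G` on the whole space (`Literature.HasWeakFDerivOn ⊤ volume u G`). Then
`‖u‖_{L^{p'}} ≤ K ‖G‖_{L^p}` with `K = SNormLESNormFDerivOfEqConst F volume p`, the constant of the
`C¹` inequality (Evans, *PDE*, §5.6.1, Thm. 1, extended by mollification: `φₙ ⋆ u → u` a.e.,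
`D(φₙ ⋆ u) = φₙ ⋆ G`, Young's inequality and Fatou's lemma; Robinson–Rodrigo–Sadowski 2016,
Thm. 1.7 (i)). If `G ∉ L^p` the right-hand side is `∞`. [cite: Evans2010, §5.6.1 Thm. 1–2] -/
theorem eLpNorm_le_eLpNorm_weakFDeriv_of_eq {u : E → F} {G : E → E →L[ℝ] F}
    (hw : FunctionSpaces.HasWeakFDerivOn (⊤ : TopologicalSpace.Opens E) volume u G) {p p' : ℝ≥0} (hp : 1 ≤ p)
    (hn : 0 < finrank ℝ E) (hp' : (p' : ℝ)⁻¹ = (p : ℝ)⁻¹ - (finrank ℝ E : ℝ)⁻¹)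
    (hup : eLpNorm u p volume < ∞) :
    eLpNorm u p' volume ≤ SNormLESNormFDerivOfEqConst F (volume : Measure E) p * eLpNorm G p volume := by
  set K : ℝ≥0 := SNormLESNormFDerivOfEqConst F (volume : Measure E) p with hK
  have hp1 : (1 : ℝ≥0∞) ≤ (p : ℝ≥0∞) := by exact_mod_cast hp
  -- local integrability and measurability of `u` and `G`
  have hu_loc : LocallyIntegrable u volume := locallyIntegrableOn_univ.1 (by
    simpa only [TopologicalSpace.Opens.coe_top] using hw.locallyIntegrableOn)
  have hG_loc : LocallyIntegrable G volume := locallyIntegrableOn_univ.1 (by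
    simpa only [TopologicalSpace.Opens.coe_top] using hw.locallyIntegrableOn_deriv)
  have hu_meas : AEStronglyMeasurable u volume := hu_loc.aestronglyMeasurable
  have hG_meas : AEStronglyMeasurable G volume := hG_loc.aestronglyMeasurable
  -- the mollifications
  obtain ⟨φ, hφ0, hφ2⟩ := FunctionSpaces.exists_contDiffBump_seq (E := E)
  have htest : ∀ n, FunctionSpaces.IsTestFunctionOn (⊤ : TopologicalSpace.Opens E) ((φ n).normed volume) :=
    fun n => FunctionSpaces.isTestFunctionOn_normed (φ n)
  set un : ℕ → E → F := fun n => (φ n).normed volume ⋆[lsmul ℝ ℝ, volume] u with hun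
  have h1 : ∀ n, ContDiff ℝ 1 (un n) := fun n => hw.contDiff_convolution (htest n)
  have hderiv : ∀ n, fderiv ℝ (un n) = (φ n).normed volume ⋆[lsmul ℝ ℝ, volume] G := fun n =>
    funext fun x => (hw.hasFDerivAt_convolution (htest n) x).fderiv
  have hun_p : ∀ n, eLpNorm (un n) p volume < ∞ := fun n =>
    (FunctionSpaces.eLpNorm_normed_convolution_le (φ n) hu_meas hp1).trans_lt hup
  -- the `C¹` inequality for each mollification, and Young for the derivative
  have hGNS : ∀ n, eLpNorm (un n) p' volume ≤ K * eLpNorm G p volume := fun n => by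
    refine (eLpNorm_le_eLpNorm_fderiv_of_eq_of_eLpNorm_lt_top volume (h1 n) hp hn hp'
      (hun_p n)).trans ?_
    rw [← hK, hderiv n]
    gcongr
    exact FunctionSpaces.eLpNorm_normed_convolution_le (φ n) hG_meas hp1
  -- a.e. convergence and Fatou
  have hlim : ∀ᵐ x ∂(volume : Measure E), Tendsto (fun n => un n x) atTop (𝓝 (u x)) :=
    FunctionSpaces.ae_tendsto_normed_convolution hφ0 hφ2 hu_loc
  have hFatou : eLpNorm u p' volume ≤ atTop.liminf fun n => eLpNorm (un n) p' volume :=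
    Lp.eLpNorm_lim_le_liminf_eLpNorm (fun n => (h1 n).continuous.aestronglyMeasurable) u hlim
  exact hFatou.trans (liminf_le_of_frequently_le' (Frequently.of_forall hGNS))

/-- **`H¹(ℝ³) ⊂ L⁶(ℝ³)` for weakly differentiable fields, with the Frobenius density.** On a
`3`-dimensional real inner product space `E`: for `u : E → F'` in `L²` with a weak gradient `G`
on the whole space (accepted `Fluid.HasWeakGradient u G`),
`‖u‖_{L⁶} ≤ K (∫⁻ |G|²)^{1/2}` with `|G(x)|² = ∑ᵢ ‖G(x) eᵢ‖²` the Frobenius density of the accepted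
dissipation functionals (`Fluid.frobeniusNormSq`, dominating the operator norm) and
`K = SNormLESNormFDerivOfEqConst F' volume 2` (Evans, *PDE*, §5.6.1; Robinson–Rodrigo–Sadowski
2016, Thm. 1.7 (i): `‖u‖_{L⁶} ≤ c ‖∇u‖_{L²}` on `W^{1,2}(ℝ³)`). [cite: Evans2010, §5.6.1 Thm. 1–2] -/
theorem eLpNorm_six_le_lintegral_frobeniusNormSq_weakGradient {F' : Type*}
    [NormedAddCommGroup F'] [InnerProductSpace ℝ F'] [FiniteDimensional ℝ F']
    (hE : finrank ℝ E = 3) {u : E → F'} {G : E → E →L[ℝ] F'} (hw : HasWeakGradient u G)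
    (hu2 : eLpNorm u 2 volume < ∞) :
    eLpNorm u 6 volume ≤ SNormLESNormFDerivOfEqConst F' (volume : Measure E) 2 *
      (∫⁻ x, ENNReal.ofReal (frobeniusNormSq (G x))) ^ (1 / 2 : ℝ) := by
  have h := eLpNorm_le_eLpNorm_weakFDeriv_of_eq hw (p := 2) (p' := 6) one_le_two (by omega)
    (by rw [hE]; norm_num) (by exact_mod_cast hu2)
  have h' : eLpNorm u 6 volume ≤
      SNormLESNormFDerivOfEqConst F' (volume : Measure E) 2 * eLpNorm G 2 volume := by
    exact_mod_cast h
  refine h'.trans ?_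
  gcongr
  -- `‖G‖_{L²} ≤ (∫⁻ |G|²)^{1/2}` from `‖G x‖² ≤ |G x|²`
  rw [eLpNorm_eq_lintegral_rpow_enorm_toReal two_ne_zero ENNReal.ofNat_ne_top, ENNReal.toReal_ofNat]
  gcongr with x
  rw [show (2 : ℝ) = ((2 : ℕ) : ℝ) by norm_num, ENNReal.rpow_natCast, ← ofReal_norm,
    ← ENNReal.ofReal_pow (norm_nonneg _)]
  exact ENNReal.ofReal_le_ofReal (sq_opNorm_le_frobeniusNormSq _)

end Literature.Analysis.FluidPDE
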